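import Summits.BirchSwinnertonDyer.BirchSwinnertonDyer.Theorems.Rank1ResidualJetCebotarevAdapter
import HarnessLib

/-!
# Crux `JetchevIrreducibleReadingByName` (item 20165, shared K8-t′ / K9), stub S5 `stub_prop44Irred`: the Prop. 4.7
# ADAPTER of the irreducible H63 chain RE-KEYED to the PRIMED, (B)-ONLY reading `h47P` — seat `bsd-potss-k8t-c4` g11;
# `--supports 20165`, helper; route-free; nothing booked, no item closed, BSD is not proved by any of this

WHY. The registered stub S5 `Sig.stub_prop44Irred` (skeleton v6 of the crux, `Cruxes/JetchevIrreducibleReadingByName/Lines/birth.lean`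
@ 9e1091d7b22d) displays [McC] Prop. 4.4 in the irreducible reading as a conjunction `(A) ∧ (B)` at every compatible
pair of Kolyvagin–Heegner data of conductors `m`, `mℓ`: (A) `p^j c_M(mℓ) ∈ Sel_λ ↔ p^j c_M(mℓ) ∈ Ker_λ` and (B)
`p^j c_M(mℓ) ∈ Ker_λ ↔ p^j c_M(m) ∈ Ker_λ` (`λ ∣ ℓ`), quantified over ALL odd `p` with `E[p]` irreducible. Two facts
from this seat's g10 work: (i) every consumer of S5 — the bottom adapter `addOrderOf_localization_kolyvaginClass_mul_eq_of_prop44Irred`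
of the H63 chain (p507696) — uses conjunct (B) ONLY; (ii) conjunct (A) is a THEOREM on the crux's rows
(`JetchevIrreducibleProp44.zsmul_kolyvaginClass_mem_selmerLocalKer_iff_mem_torsionLocalKer_of_irreducible_of_heegner`,
p530898: `E[p]` irreducible, `p ∣ N_E`, Heegner field with `d_K ∉ {−3,−4}`) — and `p ∣ N_E` holds on every row (the rows are
ADDITIVE at `p`; `Addv`), exactly as the planner PRIMED S2′/S3′ in v5. So the chain can be re-keyed to the weaker closed
statement `h47P` := S5 primed and (B)-only, and the planner can re-cut S5 ↦ `stub_prop47IrredP` := `h47P` — true on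
more ground (no `p ∤ N` overreach into the dihedral corner `K ⊆ ℚ(E[p])`, no (A)), and EXACTLY the shape that cell
`bsd-stepL`'s Zhang-currency port of x11b3's `h44` programme (seat corner-p1 g9: p530739 `Prop44.zsmul_kolyvaginClass_mem_selmerLocalKer_iff_of_le_kolyvaginIndex`,
p532010 `Prop44.exists_reductionDatum_of_not_dvd_conductorNorm`; labelled remainder Gross 1991 Prop. 3.7 (2)) composed
with (A) will deliver. This file is layer 0 of the re-key (the adapter); layers 1–4 (`…ReadingThm52RowDataPB`,
`…KernelInputsPB`, `…LocalInputsPB`, `…LocalFactsPB`) and the node (`…NamedPrintPB`) follow, each its predecessor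
byte-for-byte with `h44I ↦ h47P`.

WHAT IS PROVED. `addOrderOf_localization_kolyvaginClass_mul_eq_of_prop47IrredP`: the local orders of `c_M(mℓ)` and
`c_M(m)` at `λ ∣ ℓ` agree (the `h47` currency of bsd-jet's row theorem), for a non-CM `W`, a Heegner field `K` with
`d_K ∉ {−3,−4}`, odd `p` with `E[p]` irreducible AND `p ∣ N_E`, compatible data `d`, `d'` — from `h47P`. CONDITIONAL
on the displayed reading; nothing asserted about any curve; the crux, S5 and BSD stay open.

References: [cite: Jetchev2008, Prop. 4.4, Prop. 4.7 (p. 821), Rem. 6.2] [cite: McCallumLMS1991, §4 Prop. 4.4 (p. 301)].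
-/

set_option autoImplicit false
-- the Theorems directory repeats the summit name (sibling precedent `KatoDescentPotSupersingularAssembly.lean`)
set_option linter.dupNamespace false

noncomputable section

open scoped Classical

open WeierstrassCurve IsDedekindDomain NumberField Literature.NumberTheory.EllipticCurves
  Literature.NumberTheory.EllipticCurves.ModularForms Literature.NumberTheory.GaloisRepresentations
  Summit.BirchSwinnertonDyer.Rank1Residual.JET

namespace Summit.BirchSwinnertonDyer.BirchSwinnertonDyer.Theorems.JetchevIrreducibleH63P

/-- **[J] Prop. 4.7 (= [McC] Prop. 4.4, order comparison) in the `h47` currency, for `E[p]` IRREDUCIBLE and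
`p ∣ N_E`**, from the displayed PRIMED, (B)-ONLY reading `h47P` (= `Sig.stub_prop44Irred` of skeleton v6 with the row
binder `(p : ℤ) ∣ W.conductorNorm ℤ` inserted after irreducibility and the (A)-conjunct dropped); proof = this seat's g8
`addOrderOf_localization_kolyvaginClass_mul_eq_of_prop44Irred` (bsd-jet's `JET.addOrderOf_localization_kolyvaginClass_mul_eq_of_prop44`)
byte-for-byte with `h44I …` ↦ `h47P … hpN` and `(h j).2` ↦ `h j`. CONDITIONAL on `h47P`.
[cite: Jetchev2008, Prop. 4.4, Prop. 4.7 (p. 821)] [cite: McCallumLMS1991, §4 Prop. 4.4 (p. 301)] -/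
theorem addOrderOf_localization_kolyvaginClass_mul_eq_of_prop47IrredP
    (h47P : ∀ (W : WeierstrassCurve ℚ) [W.IsElliptic] [W.IsGloballyMinimal] [NeZero (W.conductorNorm ℤ)],
        ¬ W.HasCM →
        ∀ (K : Type) [Field K] [NumberField K], IsImaginaryQuadratic K →
        NumberField.discr K ≠ -3 → NumberField.discr K ≠ -4 →
        SatisfiesHeegnerHypothesis (W.conductorNorm ℤ) K →
        ∀ (p : ℕ) [Fact p.Prime], p ≠ 2 → W.HasIrreducibleModPGaloisRep p → (p : ℤ) ∣ W.conductorNorm ℤ →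
        ∀ (Dt : ModularParametrizationData W (W.conductorNorm ℤ)) (β : ℤ) (ι : K →+* ℂ)
          (M : ℕ), 1 ≤ M →
        ∀ (m l : ℕ), Squarefree (m * l) → l.Prime → ¬ l ∣ m →
          (∀ l' ∈ (m * l).primeFactors, Zhang2014.IsKolyvaginPrime (W.conductorNorm ℤ) W K p l' ∧
            M ≤ Zhang2014.kolyvaginIndex W p l') →
        ∀ (d : KolyvaginHeegnerData Dt β ι m) (d' : KolyvaginHeegnerData Dt β ι (m * l)),
          (∀ l' ∈ m.primeFactors, ∀ (x : ringClassField K ι m) (x' : ringClassField K ι (m * l)),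
            (x : ℂ) = x' → ((d'.σ l' x' : ringClassField K ι (m * l)) : ℂ) = (d.σ l' x : ℂ)) →
          (∀ s ∈ d.S, ∃ s' ∈ d'.S, ∀ (x : ringClassField K ι m) (x' : ringClassField K ι (m * l)),
            (x : ℂ) = x' → ((s' x' : ringClassField K ι (m * l)) : ℂ) = (s x : ℂ)) →
          (∀ s' ∈ d'.S, ∃ s ∈ d.S, ∀ (x : ringClassField K ι m) (x' : ringClassField K ι (m * l)),
            (x : ℂ) = x' → ((s' x' : ringClassField K ι (m * l)) : ℂ) = (s x : ℂ)) →
          (∀ (x : ringClassField K ι m) (x' : ringClassField K ι (m * l)),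
            (x : ℂ) = x' → d'.emb x' = d.emb x) →
        ∀ (v : HeightOneSpectrum (𝓞 K)), (l : 𝓞 K) ∈ v.asIdeal →
        ∀ (j : ℕ),
          (((p ^ j : ℕ) : ℤ) • d'.kolyvaginClass (Fact.out : p.Prime) M ∈
              (W.baseChange K).torsionLocalKer (v.adicCompletion K) ((p ^ M : ℕ) : ℤ) ↔
            ((p ^ j : ℕ) : ℤ) • d.kolyvaginClass (Fact.out : p.Prime) M ∈
              (W.baseChange K).torsionLocalKer (v.adicCompletion K) ((p ^ M : ℕ) : ℤ)))
    (W : WeierstrassCurve ℚ) [W.IsElliptic] [W.IsGloballyMinimal] [NeZero (W.conductorNorm ℤ)]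
    (hcm : ¬ W.HasCM) (K : Type) [Field K] [NumberField K] (hK : IsImaginaryQuadratic K)
    (hD3 : NumberField.discr K ≠ -3) (hD4 : NumberField.discr K ≠ -4)
    (hH : SatisfiesHeegnerHypothesis (W.conductorNorm ℤ) K)
    (p : ℕ) [Fact p.Prime] (hp2 : p ≠ 2) (hirr : W.HasIrreducibleModPGaloisRep p)
    (hpN : p ∣ W.conductorNorm ℤ)
    (Dt : ModularParametrizationData W (W.conductorNorm ℤ)) (β : ℤ) (ι : K →+* ℂ)
    (M : ℕ) (hM : 1 ≤ M) (m l : ℕ) (hml : Squarefree (m * l)) (hl : l.Prime) (hlm : ¬ l ∣ m)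
    (hK' : ∀ l' ∈ (m * l).primeFactors, Zhang2014.IsKolyvaginPrime (W.conductorNorm ℤ) W K p l' ∧
      M ≤ Zhang2014.kolyvaginIndex W p l')
    (d : KolyvaginHeegnerData Dt β ι m) (d' : KolyvaginHeegnerData Dt β ι (m * l))
    (hσ : ∀ l' ∈ m.primeFactors, ∀ (x : ringClassField K ι m) (x' : ringClassField K ι (m * l)),
      (x : ℂ) = x' → ((d'.σ l' x' : ringClassField K ι (m * l)) : ℂ) = (d.σ l' x : ℂ))
    (hS : ∀ s ∈ d.S, ∃ s' ∈ d'.S, ∀ (x : ringClassField K ι m) (x' : ringClassField K ι (m * l)),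
      (x : ℂ) = x' → ((s' x' : ringClassField K ι (m * l)) : ℂ) = (s x : ℂ))
    (hS' : ∀ s' ∈ d'.S, ∃ s ∈ d.S, ∀ (x : ringClassField K ι m) (x' : ringClassField K ι (m * l)),
      (x : ℂ) = x' → ((s' x' : ringClassField K ι (m * l)) : ℂ) = (s x : ℂ))
    (hemb : ∀ (x : ringClassField K ι m) (x' : ringClassField K ι (m * l)),
      (x : ℂ) = x' → d'.emb x' = d.emb x)
    (v : HeightOneSpectrum (𝓞 K)) (hv : (l : 𝓞 K) ∈ v.asIdeal) :
    addOrderOf ((galoisCohomology.localization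
        ((W.baseChange K).torsionGaloisModule ((p ^ M : ℕ) : ℤ)) (Sum.inr v) 1 :
          galH1Torsion (W.baseChange K) ((p ^ M : ℕ) : ℤ) →+ _)
        (d'.kolyvaginClass (Fact.out : p.Prime) M)) =
      addOrderOf ((galoisCohomology.localization
        ((W.baseChange K).torsionGaloisModule ((p ^ M : ℕ) : ℤ)) (Sum.inr v) 1 :
          galH1Torsion (W.baseChange K) ((p ^ M : ℕ) : ℤ) →+ _)
        (d.kolyvaginClass (Fact.out : p.Prime) M)) := by
  have hp : p.Prime := Fact.out
  set loc : galH1Torsion (W.baseChange K) ((p ^ M : ℕ) : ℤ) →+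
      galoisCohomology (((W.baseChange K).torsionGaloisModule ((p ^ M : ℕ) : ℤ)).toLocal (Sum.inr v)) 1 :=
    galoisCohomology.localization ((W.baseChange K).torsionGaloisModule ((p ^ M : ℕ) : ℤ)) (Sum.inr v) 1
    with hlocdef
  have hloc : ∀ (z : galH1Torsion (W.baseChange K) ((p ^ M : ℕ) : ℤ)) (j : ℕ), loc (p ^ j • z) = 0 ↔
      ((p ^ j : ℕ) : ℤ) • z ∈ (W.baseChange K).torsionLocalKer (v.adicCompletion K) ((p ^ M : ℕ) : ℤ) := by
    intro z j
    haveI : CharZero (v.adicCompletion K) := charZero_of_injective_algebraMap (algebraMap K _).injective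
    rw [hlocdef, natCast_zsmul, mem_torsionLocalKer_iff_res_eq_zero (W := W.baseChange K)
      (E := v.adicCompletion K) (pow_ne_zero M hp.ne_zero)]
    exact Iff.rfl
  have hkillL : ∀ z : galH1Torsion (W.baseChange K) ((p ^ M : ℕ) : ℤ), p ^ M • loc z = 0 := fun z ↦
    galoisCohomology.nsmul_eq_zero_of_forall
      (((W.baseChange K).torsionGaloisModule ((p ^ M : ℕ) : ℤ)).toLocal (Sum.inr v))
      (fun T ↦ by
        have h := (W.baseChange K).natAbs_nsmul_geomTorsion T
        rwa [Int.natAbs_natCast] at h) (loc z)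
  have h := h47P W hcm K hK hD3 hD4 hH p hp2 hirr (Int.natCast_dvd_natCast.mpr hpN) Dt β ι M hM m l hml hl hlm hK'
    d d' hσ hS hS' hemb v hv
  refine addOrderOf_eq_addOrderOf_of_forall_nsmul_eq_zero_iff hp (hkillL _) (hkillL _) fun j ↦ ?_
  rw [← map_nsmul, ← map_nsmul]
  exact (hloc _ j).trans ((h j).trans (hloc _ j).symm)

end Summit.BirchSwinnertonDyer.BirchSwinnertonDyer.Theorems.JetchevIrreducibleH63P

end
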